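import Summits.HubbardSuperconductivity.HubbardSuperconductivity.Theorems.AnisotropyChordTransferFibre3B1Cells

/-!
# Route `AnisotropyChord` / H0 rotor rung, LEVEL 2 family B1: the exact-integer CELL EVALUATOR of the generic bracket
(computable layer; soundness in `…Fibre3B1EvalSound`)

LEVEL2-SPEC §6 item 5 (theory-1 g21/g22): the `∀ L ≥ L₀` certificate is a finite table of L-uniform enclosures on a grid of
`ν`-cells.  For every family-B1 named sum (PartN41-B §3: `S₂…G13`, instances of `B1.torSum`) the enclosure on a cell
`ν ∈ [ν₁, ν₂]` is `loSum ν₁ ≤ θ^{2n}·torSum ≤ hiSum ν₂ + tailConst ν₂` (`B1.b1Bracket_cell`); THIS FILE turns the three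
L-independent pieces into KERNEL-EVALUABLE integers/rationals (no `Finset`, no `Real`, no `Rat` inside the 4225-term loops —
`Finset.Icc` on `ℤ` is noncomputable in the tree's Mathlib, and integer floor division is ≈ 4× faster than `ℚ` in the kernel):
* `inWin`, `allWin` (window tests), `boxPt`, `gridSum` (the `(2M+1)²` loop as nested `List.range` sums);
* `loDen νn νd q = νd·|q|² − νn` (`1/(|q|² − ν) = νd/loDen`, `ν = νn/νd`), `loTermZ`, `loSumZ` = `Σ ⌊D·νdⁿ/Π loDen^{a}⌋`
  (a LOWER bound of `D·loSum`);
* `hiDen νn νd Tn Td q = 12Tdνd|q|² − Tnνd(q₁⁴+q₂⁴) − 12Tdνn` (`1/(W_T(q) − ν) = 12Tdνd/hiDen`, `T = Tn/Td ≥ θ₀²` rational),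
  `hiTermZ`, `hiSumZ` = `Σ (⌊D·(12Tdνd)ⁿ/Π hiDen^{a}⌋ + 1)` (an UPPER bound of `D·hiSum`), `hiDenPos` (positivity test);
* `piHi = 3927/1250 ≥ π`, `tailConstQ` (the tail constant with `π ↦ piHi`, an upper bound since `tailConst` increases with `π`);
* ★ `cellCheck L₀ n₁ n₂ νd Tn Td S s a n D clo chi : Bool` — all side conditions of `b1Bracket_cell` at `θ₀ = 2π/L₀`,
  `K = L₀/4` plus `clo·D ≤ loSumZ(ν₁)` and `hiSumZ(ν₂) ≤ (chi − tailConstQ(ν₂))·D`; `…B1EvalSound.cell_sound` turns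
  `cellCheck … = true` (one `decide +kernel`, ≈ 7 s per single-factor sum at `K = 32`) into
  `clo ≤ θ^{2n}·torSum L (νθ²) s a ≤ chi` for every `L ≥ L₀` and every `ν ∈ [n₁/νd, n₂/νd]`.
Prover seat `hubbard-h0-rotor-p2` g4; helper for piece A = stmt-HubbardSuperconductivity-23918 of rung 19089
(`--supports`, helper class).  Nothing here proves superconductivity in the Hubbard model; helper definitions of ONE conditional
reduction (the GM₃ ∀L certificate, Level-2 rows); the rotor TARGET as originally worded stays FALSE (g15 verdict).
Mathlib + the tree only; no sorry.
-/

set_option linter.dupNamespace false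
set_option autoImplicit false

namespace Summit.HubbardSuperconductivity.HubbardSuperconductivity.Theorems.AnisotropyChord.Transfer.Fibre3.B1

/-! ## Window tests and the grid loop -/

/-- `q ∈ zWindow K` as a Boolean test on integers. -/
def inWin (K : ℕ) (q : ℤ × ℤ) : Bool :=
  decide (q ≠ (0, 0)) && decide (-(K : ℤ) ≤ q.1) && decide (q.1 ≤ K) && decide (-(K : ℤ) ≤ q.2) && decide (q.2 ≤ K)

/-- every shifted point `p + s_t` lies in the window. -/
def allWin (K : ℕ) {m : ℕ} (s : Fin m → ℤ × ℤ) (p : ℤ × ℤ) : Bool :=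
  (List.finRange m).all fun t => inWin K (p + s t)

/-- the grid point `(i − M, j − M)` of the box `[−M, M]²`. -/
def boxPt (M i j : ℕ) : ℤ × ℤ := ((i : ℤ) - M, (j : ℤ) - M)

/-- the loop over the box `[−M, M]²` as nested list sums. -/
def gridSum (M : ℕ) (F : ℤ × ℤ → ℤ) : ℤ :=
  ((List.range (2 * M + 1)).map fun i => ((List.range (2 * M + 1)).map fun j => F (boxPt M i j)).sum).sum

/-! ## The lower window sum in integers -/

/-- `νd·|q|² − νn`: for `ν = νn/νd`, `1/(|q|² − ν) = νd / loDen`. -/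
def loDen (νn νd : ℤ) (q : ℤ × ℤ) : ℤ := νd * (q.1 ^ 2 + q.2 ^ 2) - νn

/-- one term of `D·loSum`, rounded DOWN: `⌊D·νdⁿ / Π_t loDen(p + s_t)^{a_t}⌋` on the index set, `0` off it. -/
def loTermZ (νn νd : ℤ) (K : ℕ) {m : ℕ} (s : Fin m → ℤ × ℤ) (a : Fin m → ℕ) (n D : ℕ) (p : ℤ × ℤ) : ℤ :=
  if allWin K s p then
    ((D : ℤ) * νd ^ n) / ((List.finRange m).map fun t => loDen νn νd (p + s t) ^ a t).prod
  else 0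

/-- `loSumZ ≤ D · loSum (νn/νd) K S s a` (`…B1EvalSound.loSumZ_le`). -/
def loSumZ (νn νd : ℤ) (K S : ℕ) {m : ℕ} (s : Fin m → ℤ × ℤ) (a : Fin m → ℕ) (n D : ℕ) : ℤ :=
  gridSum (K + S) (loTermZ νn νd K s a n D)

/-! ## The upper window sum in integers -/

/-- `12·Td·νd·|q|² − Tn·νd·(q₁⁴ + q₂⁴) − 12·Td·νn = 12·Td·νd·(W_T(q) − ν)`, `T = Tn/Td`, `ν = νn/νd`. -/
def hiDen (νn νd Tn Td : ℤ) (q : ℤ × ℤ) : ℤ :=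
  12 * Td * νd * (q.1 ^ 2 + q.2 ^ 2) - Tn * νd * (q.1 ^ 4 + q.2 ^ 4) - 12 * Td * νn

/-- one term of `D·hiSum`, rounded UP: `⌊D·(12Tdνd)ⁿ / Π_t hiDen(p + s_t)^{a_t}⌋ + 1` on the index set, `0` off it. -/
def hiTermZ (νn νd Tn Td : ℤ) (K : ℕ) {m : ℕ} (s : Fin m → ℤ × ℤ) (a : Fin m → ℕ) (n D : ℕ) (p : ℤ × ℤ) : ℤ :=
  if allWin K s p then
    ((D : ℤ) * (12 * Td * νd) ^ n) / ((List.finRange m).map fun t => hiDen νn νd Tn Td (p + s t) ^ a t).prod + 1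
  else 0

/-- `D · hiSum (νn/νd) θ₀ K S s a ≤ hiSumZ` whenever `θ₀² ≤ Tn/Td` and `hiDenPos` (`…B1EvalSound.hiSum_le_hiSumZ`). -/
def hiSumZ (νn νd Tn Td : ℤ) (K S : ℕ) {m : ℕ} (s : Fin m → ℤ × ℤ) (a : Fin m → ℕ) (n D : ℕ) : ℤ :=
  gridSum (K + S) (hiTermZ νn νd Tn Td K s a n D)

/-- positivity of every `hiDen` on the punctured window `zWindow K`. -/
def hiDenPos (νn νd Tn Td : ℤ) (K : ℕ) : Bool :=
  (List.range (2 * K + 1)).all fun i => (List.range (2 * K + 1)).all fun j =>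
    !(inWin K (boxPt K i j)) || decide (0 < hiDen νn νd Tn Td (boxPt K i j))

/-! ## The tail constant in rationals -/

/-- a rational upper bound of `π`: `3.1416 = 3927/1250` (`Real.pi_lt_d4`). -/
def piHi : ℚ := 3927 / 1250

/-- `tailConst (νn/νd) K' n` with `π ↦ piHi`: an upper bound (the constant increases with `π`). -/
def tailConstQ (νn νd : ℤ) (K' n : ℕ) : ℚ :=
  (piHi ^ 2 / 4) ^ n * piHi
    / ((((K' : ℚ) + 1) ^ 2 - (νn : ℚ) / νd * piHi ^ 2 / 4) ^ (n - 2) * ((K' : ℚ) ^ 2 - (νn : ℚ) / νd * piHi ^ 2 / 4))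

/-! ## The cell certificate -/

/-- ★ THE CELL CERTIFICATE of a named B1 sum on the `ν`-cell `[n₁/νd, n₂/νd]` at `θ₀ = 2π/L₀`, `K = L₀/4`:
side conditions of `b1Bracket_cell` (`0 < νd`, `0 ≤ n₁ ≤ n₂`, `n₂/νd < 4/piHi²`, `(2·piHi/L₀)² ≤ Tn/Td`, `2 + 2S ≤ K`,
exponents `≥ 1` summing to `n ≥ 2`, `|s_t|∞ ≤ S`, `hiDenPos`), and the two evaluations
`clo·D ≤ loSumZ(n₁)` and `hiSumZ(n₂) ≤ (chi − tailConstQ(n₂))·D`. -/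
def cellCheck (L0 : ℕ) (n1 n2 νd Tn Td : ℤ) (S : ℕ) {m : ℕ} (s : Fin m → ℤ × ℤ) (a : Fin m → ℕ) (n D : ℕ)
    (clo chi : ℚ) : Bool :=
  decide (0 < νd) && decide (0 < Td) && decide (0 ≤ n1) && decide (n1 ≤ n2) &&
  decide ((n2 : ℚ) / νd * piHi ^ 2 < 4) &&
  decide ((2 * piHi / L0) ^ 2 * Td ≤ Tn) &&
  decide (2 + 2 * S ≤ L0 / 4) && decide (0 < D) && decide (2 ≤ n) &&
  decide (((List.finRange m).map a).sum = n) &&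
  ((List.finRange m).all fun t => decide (1 ≤ a t) && decide ((s t).1.natAbs ≤ S) && decide ((s t).2.natAbs ≤ S)) &&
  hiDenPos n2 νd Tn Td (L0 / 4) &&
  decide (clo * D ≤ (loSumZ n1 νd (L0 / 4) S s a n D : ℚ)) &&
  decide (((hiSumZ n2 νd Tn Td (L0 / 4) S s a n D : ℤ) : ℚ) ≤ (chi - tailConstQ n2 νd (L0 / 4 - 2 * S) n) * D)

end Summit.HubbardSuperconductivity.HubbardSuperconductivity.Theorems.AnisotropyChord.Transfer.Fibre3.B1
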